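import Summits.ValiantsHypothesis.ValiantsHypothesis.Theses.SymPencil
import Summits.ValiantsHypothesis.ValiantsHypothesis.Theses.ProofCarryingSymmetry
import Literature.Computability.AlgebraicComplexity.DawarWilsenach2025Thm71
import Summits.ValiantsHypothesis.ValiantsHypothesis.Theorems.SymPencilSdcThesisSplit
import Summits.ValiantsHypothesis.ValiantsHypothesis.Theorems.SymPencilEquivariantSdcNotQPStubToSymmetricCircuit
import Summits.ValiantsHypothesis.ValiantsHypothesis.Theorems.SymPencilEquivariantSdcNotQPPermEmbeddingOfYoungFixedVector
import Summits.ValiantsHypothesis.ValiantsHypothesis.Theorems.SymPencilEquivariantSdcNotQPYoungDegreeBound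
import HarnessLib

/-!
# ValiantsHypothesis / SymPencil — crux `EquivariantSdcNotQP` (stmt-ValiantsHypothesis-17792): THE CLOSING
# COMPOSITION (line `birth_EquivariantSdcNotQP`)

Port under `Theorems/` of the kernel-checked composition of the registered skeleton
`Cruxes/SdcThesis/Lines/birth_EquivariantSdcNotQP.lean` (§Arithmetic + `equivariantSdcNotQP_of`):
a quasi-polynomial family of `Γ_n`-equivariant SYMMETRIC affine pencils for `per_n`
⇒ (`stub_permify`: permutation lifts at quasi-polynomial cost) ⇒ (`stub_toSymmetricCircuit`, LANDED
`…Theorems.SymPencilEquivariantSdcNotQP.stub_toSymmetricCircuit`) `𝔖_n`-symmetric circuits for `per_n` of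
size `2^{polylog n}` ⇒ contradiction with Dawar–Wilsenach's `2^{Ω(n)}` infinitely often
(`ProofCarryingSymmetry.SquareSymmetricPermLB`, PROVED in the tree: `DawarWilsenach2025_thm71_holds`).
The qp ∘ qp bookkeeping `qpBound_comp_qpBound` is imported from `…SymPencilSdcThesisSplit`.
`equivariantSdcNotQP_of_stubs h₁ h₂` concludes the crux `SymPencil.EquivariantSdcNotQP` BY NAME from the
two stub statements as hypotheses; `EquivariantSdcNotQP_of_permify h₁` discharges `h₂` by the landed
`stub_toSymmetricCircuit`; and **`EquivariantSdcNotQP_proof : SymPencil.EquivariantSdcNotQP`** discharges `h₁`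
(= the statement of `stub_permify`) by `permify_of_youngFixedVector youngFixedVector_holds`: val-lit-p7 g11's
reduction `(H2) → ⟨stub_permify⟩` (p598818, over its PROVED spin dichotomy `spinDichotomy_symmetric` p598387,
the conjugation normal form / finite lift / Frobenius retract chain of p7 g9–g10) applied to val-lit-p6 g12's
PROVED (H2) `YoungBounds.youngFixedVector_holds` (p597579: Young's rule, completeness of the Specht modules,
the tableaux degree inequality).  So crux 17792 `SymPencil.EquivariantSdcNotQP` — no quasi-polynomial family
of `Γ_n`-equivariant SYMMETRIC affine determinantal representations of `per_n` — is a THEOREM of the tree.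

Honest framing: a crux of the conditional route SymPencil (its sibling `SymmetrizePermPairs`, the deciding
`SdcThesis`, V0/V1/V6 and `VP ≠ VNP` remain OPEN; `VP ≠ VNP` is NOT proved and nothing here is progress on
it beyond this equivariant/symmetric model, a Landsberg–Ressayre / Dawar–Wilsenach-class statement).
-/

noncomputable section

set_option linter.dupNamespace false

namespace Summit.ValiantsHypothesis.ValiantsHypothesis.Theorems.SymPencilEquivariantSdcNotQP.Closer

open Literature.Computability.AlgebraicComplexity MvPolynomial Matrix
open Summit.ValiantsHypothesis.ValiantsHypothesis.Theses
open Summit.ValiantsHypothesis.ValiantsHypothesis.Theorems.SymPencilSdcThesisSplit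

/-! ### Arithmetic -/

/-- Size bookkeeping: `(2^k + 2)^e ≤ 2^{e (L + c + 3)^{c+1}}` when `k = (L + c)^c`. [folklore] -/
theorem size_exp_bound (L c e : ℕ) :
    (2 ^ ((L + c) ^ c) + 2) ^ e ≤ 2 ^ (e * (L + c + 3) ^ (c + 1)) := by
  have hexp : (L + c) ^ c + 2 ≤ (L + c + 3) ^ (c + 1) := by
    rcases c with _ | c
    · simp
    · set b := L + (c + 1) + 3 with hb
      have hk : (L + (c + 1)) ^ (c + 1) ≤ b ^ (c + 1) := Nat.pow_le_pow_left (by omega) _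
      have hbb : b ≤ b ^ (c + 1) := by
        calc b = b ^ 1 := (pow_one b).symm
          _ ≤ b ^ (c + 1) := Nat.pow_le_pow_right (by omega) (by omega)
      calc (L + (c + 1)) ^ (c + 1) + 2 ≤ b ^ (c + 1) + b ^ (c + 1) := by omega
        _ = 2 * b ^ (c + 1) := by ring
        _ ≤ b * b ^ (c + 1) := Nat.mul_le_mul_right _ (by omega)
        _ = b ^ (c + 1 + 1) := by ring
  have hstep : 2 ^ ((L + c) ^ c) + 2 ≤ 2 ^ ((L + c) ^ c + 2) := by
    have h1 : 1 ≤ 2 ^ ((L + c) ^ c) := Nat.one_le_two_pow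
    calc 2 ^ ((L + c) ^ c) + 2 ≤ 4 * 2 ^ ((L + c) ^ c) := by omega
      _ = 2 ^ ((L + c) ^ c + 2) := by ring
  calc (2 ^ ((L + c) ^ c) + 2) ^ e ≤ (2 ^ ((L + c) ^ c + 2)) ^ e := Nat.pow_le_pow_left hstep e
    _ = 2 ^ (((L + c) ^ c + 2) * e) := by rw [← pow_mul]
    _ ≤ 2 ^ ((L + c + 3) ^ (c + 1) * e) :=
        Nat.pow_le_pow_right (by norm_num) (Nat.mul_le_mul_right e hexp)
    _ = 2 ^ (e * (L + c + 3) ^ (c + 1)) := by rw [mul_comm]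

/-- Polylog is eventually below any linear function: `(⌊log₂ n⌋ + K)^k < δ n` for `n ≥ N(k,K,δ)`
(from Mathlib's `Real.tendsto_pow_log_div_mul_add_atTop`). [folklore] -/
theorem polylog_eventually_lt (k K : ℕ) {δ : ℝ} (hδ : 0 < δ) :
    ∃ N : ℕ, ∀ n ≥ N, ((Nat.log 2 n : ℝ) + K) ^ k < δ * n := by
  have ht := Real.tendsto_pow_log_div_mul_add_atTop 1 0 k one_ne_zero
  set M : ℝ := (2 / Real.log 2) ^ k with hM
  have hlog2 : 0 < Real.log 2 := Real.log_pos one_lt_two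
  have hMpos : 0 < M := by positivity
  have hev : ∀ᶠ x : ℝ in Filter.atTop, Real.log x ^ k / (1 * x + 0) < δ / M :=
    ht.eventually_lt_const (by positivity)
  obtain ⟨X₀, hX₀⟩ := Filter.eventually_atTop.1 hev
  refine ⟨max (max ⌈X₀⌉₊ (2 ^ K)) 1, fun n hn => ?_⟩
  have hn1 : 1 ≤ n := le_trans (le_max_right _ _) hn
  have hnX' : ⌈X₀⌉₊ ≤ n := le_trans (le_trans (le_max_left _ _) (le_max_left _ _)) hn
  have hnX : X₀ ≤ (n : ℝ) := le_trans (Nat.le_ceil X₀) (by exact_mod_cast hnX')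
  have hnK : 2 ^ K ≤ n := le_trans (le_trans (le_max_right _ _) (le_max_left _ _)) hn
  have hnpos : (0 : ℝ) < n := by exact_mod_cast hn1
  have ha : (Nat.log 2 n : ℝ) ≤ Real.log n / Real.log 2 := by
    rw [le_div_iff₀ hlog2]
    have h := Nat.pow_log_le_self 2 (show n ≠ 0 by omega)
    have h' : (2 : ℝ) ^ Nat.log 2 n ≤ n := by exact_mod_cast h
    calc (Nat.log 2 n : ℝ) * Real.log 2 = Real.log ((2 : ℝ) ^ Nat.log 2 n) := by
          rw [Real.log_pow]
      _ ≤ Real.log n := Real.log_le_log (by positivity) h'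
  have hb : (K : ℝ) ≤ Real.log n / Real.log 2 := by
    rw [le_div_iff₀ hlog2]
    have h' : (2 : ℝ) ^ K ≤ n := by exact_mod_cast hnK
    calc (K : ℝ) * Real.log 2 = Real.log ((2 : ℝ) ^ K) := by rw [Real.log_pow]
      _ ≤ Real.log n := Real.log_le_log (by positivity) h'
  have hc : (Nat.log 2 n : ℝ) + K ≤ 2 / Real.log 2 * Real.log n := by
    have : 2 / Real.log 2 * Real.log n = Real.log n / Real.log 2 + Real.log n / Real.log 2 := by ring
    rw [this]
    exact add_le_add ha hb
  have h0 : 0 ≤ (Nat.log 2 n : ℝ) + K := by positivity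
  have hd : ((Nat.log 2 n : ℝ) + K) ^ k ≤ M * Real.log n ^ k := by
    calc ((Nat.log 2 n : ℝ) + K) ^ k ≤ (2 / Real.log 2 * Real.log n) ^ k := pow_le_pow_left₀ h0 hc k
      _ = M * Real.log n ^ k := by rw [mul_pow]
  have he : Real.log n ^ k < δ / M * n := by
    have := hX₀ n hnX
    rw [one_mul, add_zero, div_lt_iff₀ hnpos] at this
    exact this
  calc ((Nat.log 2 n : ℝ) + K) ^ k ≤ M * Real.log n ^ k := hd
    _ < M * (δ / M * n) := mul_lt_mul_of_pos_left he hMpos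
    _ = δ * n := by field_simp

/-! ### Dawar–Wilsenach, discharged -/

/-- Dawar–Wilsenach's lower bound (ToC 2025 Thm. 7.1) is PROVED in the tree
(`DawarWilsenach2025_thm71_holds`): the shared obligation `ProofCarryingSymmetry.SquareSymmetricPermLB` in one
line by its size form at `F = ℂ`. [cite: DawarWilsenach2025, Thm. 7.1] -/
theorem squareSymmetricPermLB_holds : ProofCarryingSymmetry.SquareSymmetricPermLB :=
  fun G _ C hs hp => DawarWilsenach2025_thm71.size_form DawarWilsenach2025_thm71_holds ℂ G C hs hp

/-! ### The composition -/

/-- **`SymPencil.EquivariantSdcNotQP` from the two stub statements** (the registered composition of the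
line `birth_EquivariantSdcNotQP`, ported verbatim): qp family of `Γ_n`-equivariant symmetric pencils
⇒ (h₁, permify) qp pencils with permutation lifts ⇒ (h₂, toSymmetricCircuit) `𝔖_n`-symmetric circuits of
size `2^{polylog n}` ⇒ contradiction with Dawar–Wilsenach's `2^{ε n}` infinitely often. [folklore] -/
theorem equivariantSdcNotQP_of_stubs
    (h₁ : ∃ d : ℕ, ∀ (n m : ℕ) (A : Matrix (Fin m) (Fin m) (MvPolynomial (Fin n × Fin n) ℂ)),
      A.IsSymm → IsEquivariantDetRepr (Subgroup.closure {γ : GL (Fin n × Fin n) ℂ |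
        ∃ π ρ : Equiv.Perm (Fin n), (γ : Matrix (Fin n × Fin n) (Fin n × Fin n) ℂ) =
          Equiv.Perm.permMatrix ℂ (Equiv.prodCongr π ρ)}) (perPoly (Fin n) ℂ) A →
      ∃ m' ≤ 2 ^ ((Nat.log 2 m + d) ^ d),
        ∃ A' : Matrix (Fin m') (Fin m') (MvPolynomial (Fin n × Fin n) ℂ),
          IsAffineDetRepr (perPoly (Fin n) ℂ) A' ∧
          ∀ π ρ : Equiv.Perm (Fin n), ∃ σ : Equiv.Perm (Fin m'),
            A'.map (MvPolynomial.rename fun ij : Fin n × Fin n => (π ij.1, ρ ij.2)) =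
              (σ.permMatrix ℂ).map MvPolynomial.C * A' * ((σ.permMatrix ℂ)ᵀ).map MvPolynomial.C)
    (h₂ : ∃ e : ℕ, ∀ (n m' : ℕ) (A' : Matrix (Fin m') (Fin m') (MvPolynomial (Fin n × Fin n) ℂ)),
      IsAffineDetRepr (perPoly (Fin n) ℂ) A' →
      (∀ σ : Equiv.Perm (Fin n), ∃ τ : Equiv.Perm (Fin m'),
        A'.map (MvPolynomial.rename fun ij : Fin n × Fin n => (σ ij.1, σ ij.2)) =
          (τ.permMatrix ℂ).map MvPolynomial.C * A' * ((τ.permMatrix ℂ)ᵀ).map MvPolynomial.C) →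
      ∃ (G : Type) (_ : Fintype G) (C : LabelledArithCircuit ℂ (Fin n × Fin n) Unit G),
        C.IsSymmetric (Equiv.Perm (Fin n)) ∧ C.eval (C.output ()) = perPoly (Fin n) ℂ ∧
          Fintype.card G ≤ (m' + 2) ^ e) :
    SymPencil.EquivariantSdcNotQP := by
  have h₃ : ProofCarryingSymmetry.SquareSymmetricPermLB := squareSymmetricPermLB_holds
  rintro ⟨c, hc⟩
  obtain ⟨d, hd⟩ := h₁
  obtain ⟨e, he⟩ := h₂
  set c' : ℕ := (c + 1) * (d + 1) with hc'
  -- Step 1: symmetric circuits of size 2^{e (log₂ n + c' + 3)^{c'+1}} for every n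
  have key : ∀ n : ℕ, ∃ (G : Type) (_ : Fintype G) (C : LabelledArithCircuit ℂ (Fin n × Fin n) Unit G),
      C.IsSymmetric (Equiv.Perm (Fin n)) ∧ C.eval (C.output ()) = perPoly (Fin n) ℂ ∧
        Fintype.card G ≤ 2 ^ (e * (Nat.log 2 n + c' + 3) ^ (c' + 1)) := by
    intro n
    obtain ⟨m, hm, A, hAs, hA⟩ := hc n
    obtain ⟨m', hm', A', hA', hperm⟩ := hd n m A hAs hA
    obtain ⟨G, hG, C, hCs, hCe, hcard⟩ := he n m' A' hA' (fun σ => hperm σ σ)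
    refine ⟨G, hG, C, hCs, hCe, hcard.trans ?_⟩
    have hm'' : m' ≤ 2 ^ ((Nat.log 2 n + c') ^ c') := hm'.trans (qpBound_comp_qpBound hm)
    calc (m' + 2) ^ e ≤ (2 ^ ((Nat.log 2 n + c') ^ c') + 2) ^ e := Nat.pow_le_pow_left (by omega) e
      _ ≤ 2 ^ (e * (Nat.log 2 n + c' + 3) ^ (c' + 1)) := size_exp_bound _ c' e
  choose G hG C hCs hCe hcard using key
  obtain ⟨ε, hε, hio⟩ := @h₃ G hG C hCs hCe
  -- Step 2: the exponent is polylog, eventually below ε n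
  have hδ : (0 : ℝ) < ε / (e + 1) := by positivity
  obtain ⟨N, hN⟩ := polylog_eventually_lt (c' + 1) (c' + 3) hδ
  obtain ⟨n, hn, hbig⟩ := hio N
  have h1 := hN n hn
  have hnpos : (0 : ℝ) < n := by
    by_contra h0
    rw [not_lt] at h0
    have hz : (n : ℝ) = 0 := le_antisymm h0 (Nat.cast_nonneg n)
    rw [hz, mul_zero] at h1
    exact absurd h1 (not_lt.2 (by positivity))
  have he0 : (0 : ℝ) ≤ e := Nat.cast_nonneg e
  have h1' : (e : ℝ) * (((Nat.log 2 n + c' + 3 : ℕ) : ℝ)) ^ (c' + 1) ≤ (e : ℝ) * (ε / (e + 1) * n) := by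
    have heq : (((Nat.log 2 n + c' + 3 : ℕ) : ℝ)) = (Nat.log 2 n : ℝ) + ((c' + 3 : ℕ) : ℝ) := by
      push_cast; ring
    rw [heq]
    exact mul_le_mul_of_nonneg_left h1.le he0
  have hexpR : ((e * (Nat.log 2 n + c' + 3) ^ (c' + 1) : ℕ) : ℝ) < ε * n := by
    rw [Nat.cast_mul, Nat.cast_pow]
    calc (e : ℝ) * (((Nat.log 2 n + c' + 3 : ℕ) : ℝ)) ^ (c' + 1) ≤ (e : ℝ) * (ε / (e + 1) * n) := h1'
      _ = (e / (e + 1)) * (ε * n) := by ring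
      _ < 1 * (ε * n) := by
          apply mul_lt_mul_of_pos_right _ (by positivity)
          rw [div_lt_one (by positivity)]
          linarith
      _ = ε * n := one_mul _
  -- Step 3: 2^{ε n} ≤ |C_n| ≤ 2^{exponent} forces ε n ≤ exponent, contradiction
  have hsizeR : (Fintype.card (G n) : ℝ) ≤
      (2 : ℝ) ^ (((e * (Nat.log 2 n + c' + 3) ^ (c' + 1) : ℕ)) : ℝ) := by
    rw [Real.rpow_natCast]
    exact_mod_cast hcard n
  have hchain := (Real.rpow_le_rpow_left_iff one_lt_two).1 (hbig.trans hsizeR)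
  linarith

/-- **The crux from `stub_permify` alone**: `stub_toSymmetricCircuit` is LANDED
(`…Theorems.SymPencilEquivariantSdcNotQP.stub_toSymmetricCircuit`), so `SymPencil.EquivariantSdcNotQP`
follows from the statement of `stub_permify`. [folklore] -/
theorem EquivariantSdcNotQP_of_permify
    (h₁ : ∃ d : ℕ, ∀ (n m : ℕ) (A : Matrix (Fin m) (Fin m) (MvPolynomial (Fin n × Fin n) ℂ)),
      A.IsSymm → IsEquivariantDetRepr (Subgroup.closure {γ : GL (Fin n × Fin n) ℂ |
        ∃ π ρ : Equiv.Perm (Fin n), (γ : Matrix (Fin n × Fin n) (Fin n × Fin n) ℂ) =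
          Equiv.Perm.permMatrix ℂ (Equiv.prodCongr π ρ)}) (perPoly (Fin n) ℂ) A →
      ∃ m' ≤ 2 ^ ((Nat.log 2 m + d) ^ d),
        ∃ A' : Matrix (Fin m') (Fin m') (MvPolynomial (Fin n × Fin n) ℂ),
          IsAffineDetRepr (perPoly (Fin n) ℂ) A' ∧
          ∀ π ρ : Equiv.Perm (Fin n), ∃ σ : Equiv.Perm (Fin m'),
            A'.map (MvPolynomial.rename fun ij : Fin n × Fin n => (π ij.1, ρ ij.2)) =
              (σ.permMatrix ℂ).map MvPolynomial.C * A' * ((σ.permMatrix ℂ)ᵀ).map MvPolynomial.C) :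
    SymPencil.EquivariantSdcNotQP :=
  equivariantSdcNotQP_of_stubs h₁ SymPencilEquivariantSdcNotQP.stub_toSymmetricCircuit

/-- **Crux `SymPencil.EquivariantSdcNotQP` (stmt-ValiantsHypothesis-17792) — PROVED.**  There is no
quasi-polynomial family of `Γ_n ≅ 𝔖_n × 𝔖_n`-equivariant symmetric affine determinantal representations of
the permanent: `stub_permify` (= `permify_of_youngFixedVector youngFixedVector_holds`: conjugation normal
form, finite central lift, spin dichotomy, Young fixed vectors — permutation lifts at quasi-polynomial cost)
and `stub_toSymmetricCircuit` (Dawar–Wilsenach's symmetric determinant circuits) turn such a family into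
`𝔖_n`-symmetric circuits for `per_n` of size `2^{polylog n}`, contradicting Dawar–Wilsenach's `2^{Ω(n)}`
lower bound (ToC 2025, Thm. 7.1).  Route SymPencil is conditional; `VP ≠ VNP` is NOT proved. [folklore] -/
theorem EquivariantSdcNotQP_proof : Summit.ValiantsHypothesis.ValiantsHypothesis.Theses.SymPencil.EquivariantSdcNotQP :=
  EquivariantSdcNotQP_of_permify
    (SymPencilEquivariantSdcNotQP.permify_of_youngFixedVector YoungBounds.youngFixedVector_holds)

end Summit.ValiantsHypothesis.ValiantsHypothesis.Theorems.SymPencilEquivariantSdcNotQP.Closer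

end
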